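import Literature.MathematicalPhysics.QuantumFieldTheory.Balaban1983to89.B1LowerBound114Model
import Literature.MathematicalPhysics.QuantumFieldTheory.Balaban1983to89.B1Eq115GeneratingFunctional

/-!
# `Balaban1983to89.B1LowerBound114ModelWith` — T. Bałaban, *(Higgs)₂,₃ quantum fields in a finite volume. I. A lower bound*,
Commun. Math. Phys. **85** (1982) 603–626 [Balaban1982Higgs1]: the LOWER HALF of the Theorem (1.14) p. 606 AT THE CONCRETE CUTOFF
FAMILY of the lattice model **WITH AN ARBITRARY VACUUM COUNTERTERM `E₁`** — p14's per-lattice ledger `B1LowerBound114Model.Inputs`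
(whose action is pinned at the v1.0 couplings `couplings D P`, `E = E₀ + e1`, the located-defective two-sided reading of (1.13))
RE-THREADED ONCE over `E₁ : Params → ℝ` (`InputsWith D U E₁ P`, action at the typer's `couplingsWith D P (E₁ P)`), and the assembly
`exp(−E₋|T_ε|) ≤ Z^ε` with ONE ε-independent `E₋ = U.eMinus D` run at that generality: `LowerBoundWith (D.cutoffFamilyWith E₁) E₋`,
`LowerBound114With D E₁`, and at r01's REPAIRED decl of record (`E₁ = e1R`, the one-sided (1.13)): **`lowerBound114R_of_inputs`**.

statement-level skeleton of published theorems with citation tags; proofs where landed; nothing here is a claim about the Yang–Mills mass gap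

PDF held: `paper:balaban1982-cmp85-higgs23-i` (journal page = PDF page + 602); pp. 605–606 [PDF 3–4] ((1.10)–(1.14)), p. 624–625 [PDF 22–23]
((3.66)–(3.69)), read as images on the ×2 renders `run/shared/lean/pub/pub-balaban/b2b-balaban-ref1/pages/1982-cmp85-higgs23-I/…-p004-x2.png`
(p. 606) by this seat; pp. 624–625 as read by p14 (`B1LowerBound114Model`).

CITATION HEADER (lean-in-tree rule).  Cell `lit-balaban` (HOME `run/shared/lean/pub/lit-balaban/`), reader/typer seat **r14** gen 16
(unit `lit-balaban-r14`, B1 fold owner; TAKING line HOME/STATUS.md 2026-08-22T17:31:30Z, free-target protocol G.5-34(d); referee FYI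
ref-4 **S-B1-g48-1**: *"re-thread `B1LowerBound114Model`, `B1Ineq368QuadForms`, `B1Eq369Model`, `B1Eq115GeneratingFunctional` to
`Thm114With` / `Thm114R` (`e1R`); the v1.0 `e1` stays as settled text"* — the typer did `B1Eq115GeneratingFunctional` v1.1 (p332114),
this file does `B1LowerBound114Model`), SKELETON row **B1.Thm@606** (decl of record r14's `B1LowerBound.ThmPrinted` p239114; concrete
instance r01's `Thm114R` / `cutoffFamilyR` / generic `Thm114With E₁` (p331274); lower-half assembly p252119; model ledger p14's
`B1LowerBound114Model` p253966) — cells only, NO head change.  USED BY NAME, never restated: r01's `B1Sect1Statements.ModelData.{zRenWith,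
cutoffFamilyWith, e1, e1R, Admissible}`, `LowerBound114With`, `LowerBound114R`, `LowerBound114`, `volT` (p239833/p331274); the typer's
`B1Eq115GeneratingFunctional.{couplingsWith, zRenWith_eq_partitionFn}` (p332114); p14's `B1LowerBound114Model.{Consts, Consts.eMinus, Inputs,
couplings, boxConst_le_of_stop, volT_nonneg, lowerBound114_of_inputs}` (p253966) and the ENGINE `B1Ineq368BoxBound.lowerBound_model` (p253232:
the end of Sect. 3 on ONE lattice for ARBITRARY couplings `c` — which is why the re-threading costs nothing analytic); r14's
`B1LowerBound.{LowerBoundWith, LowerBoundPrinted}` (p239114).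

WHAT IS PRINTED (p. 606 [PDF 4], verbatim): *"The constant E₁ is given again by a perturbation expansion which can be written as
E₁ = Σ_{1≤α+β≤n̄} (1/(α!β!)) e^αλ^β (∂^{α+β}/(∂e^α∂λ^β) log∫dA∫dφ exp(−S^ε(A,φ) + E))|_{e=λ=0}. (1.13)  Now the fundamental result of this
paper can be formulated. **Theorem.** For the dimensions d = 2, 3 there exist the constants E₋, E₊ independent of ε, T_ε and such that
exp(−E₋|T_ε|) ≦ Z^ε ≦ exp(E₊|T_ε|). (1.14)"*; p. 605 [PDF 3]: *"The constant E in (1.12) ⟦sic: (1.11)⟧ is a sum E = E₀ + E₁"*; p. 625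
[PDF 23]: *"We get Z^ε ≧ Z_KZ_K(0)exp(−E₀ + O(1)|T_ε|). (3.68) … and we obtain finally the required lower bound."*

WHY (the located defect, typer g24 `B1Eq113OneSidedDerivatives` p330976/p331947, r01 v1.1 p331274): with Lean's two-sided
`iteratedDeriv` the v1.0 `ModelData.e1` drops every `λ`-counterterm of (1.13) for `N ≥ 1`; r01's repaired `e1R` takes the
`λ′`-derivatives from the right at `0⁺`, and the counterterm-GENERIC family `cutoffFamilyWith E₁` carries both readings.  p14's model ledger
of the lower bound (this row's concrete-instance assembly) is stated at `D.cutoffFamily` (`E₁ = e1`) only; since its analytic engine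
`lowerBound_model` is coupling-generic, the ledger re-threads verbatim.

WHAT THIS FILE PROVES (kernel-checked, zero `sorry`; one structure + theorems; no `Prop`-valued fact).
* §1 **`InputsWith D U E₁ P`** — THE DISPLAYED INPUTS OF SECTS. 2–3 ON ONE LATTICE `P` for the action with vacuum counterterm `E₁ P`:
  field for field p14's `Inputs D U P` (stopping scale `K` with `L^Kε ≤ ε₀ < L^{K+1}ε`, thresholds `(ℓ_k, p_k)`, effective actions
  `S^{(k)}` with `exp(−S^{(k)}) ∈ L¹`, the (3.26) step bound `h360`, the (3.66) data with (E1)/(E2)/(E3), the bounded quadratic forms `hQ`,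
  the (3.69) conjunct `h369`) EXCEPT `h0 : S 0 = action D.C (couplingsWith D P (E₁ P))`; the dictionary `Inputs.toWith : Inputs D U P →
  InputsWith D U D.e1 P` and `InputsWith.toInputs : InputsWith D U D.e1 P → Inputs D U P` (p14's `couplings D P` IS `couplingsWith D P (e1 P)`,
  `rfl`).
* §2 **`lowerBound_latticeWith`**: per lattice, `exp(−E₋|T_ε|) ≤ zRenWith P (E₁ P)` with the ε-INDEPENDENT `E₋ = U.eMinus D` (p14's proof,
  the engine fed with `couplingsWith`); **`lowerBoundWith_cutoffFamilyWith`**: if every admissible lattice carries `InputsWith D U E₁ P` then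
  `B1LowerBound.LowerBoundWith (D.cutoffFamilyWith E₁) (U.eMinus D)`; `lowerBoundPrinted_cutoffFamilyWith`; **`lowerBound114With_of_inputs`**
  (r01's `LowerBound114With D E₁`); `lowerBound_explicitWith`.
* §3 the two instances: **`lowerBound114R_of_inputs`** — r01's REPAIRED decl of record `LowerBound114R D` from `InputsWith D U D.e1R P` on
  every admissible lattice (constants `U` chosen before the lattice); `lowerBound114_of_inputsWith` — p14's v1.0 `LowerBound114 D` recovered
  from the generic theorem at `E₁ = e1` (consistency: equal to p14's `lowerBound114_of_inputs ∘ toInputs`).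
HONEST SCOPE.  (i) Exactly as in p14's file, NOTHING analytic is proved: Props. 2.1–2.3, 3.1, 3.2, (3.38)–(3.60), (3.69) enter as the fields
of `InputsWith` (per lattice, uniform constants `Consts`) — the hypotheses of `B1Ineq368BoxBound.lowerBound_model`; what is proved is the
bookkeeping from those inputs to ONE constant `E₋` for the whole family, now for every vacuum counterterm `E₁` and in particular for the
repaired `e1R`.  (ii) The TOP ledger only: p14's three Pre-ledgers (`B1Ineq368QuadForms.PreInputs` → `hQ` discharged, `B1Eq369Model.PreInputs369`
→ `h369` discharged, `B1LowerBound114TorusE3.PreInputsE3` → `hE3` discharged) also pin their `h0` at the v1.0 `couplings`; their discharges do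
not involve `E₁`, and their generic copies (same structures with `h0` at `couplingsWith`) are mechanical — left to the seat that next touches
those cells (ref-4: *"when those cells are next touched"*).  (iii) `Inputs`/`InputsWith` are typed ledgers: no instance with the analytic fields
discharged exists in the tree (that is the content of Parts I–III).  (iv) `K ≤` the `K` of (1.2), `L > 1`, *"m² > 0"* as in p14's file.
Value = the row's concrete-instance assembly stated at the decl of record `LowerBound114R` / `Thm114With`; NOT summit progress.
-/

open _root_.MeasureTheory

namespace Literature.MathematicalPhysics.QuantumFieldTheory.Balaban1983to89.B1LowerBound114ModelWith

open Literature.MathematicalPhysics.QuantumFieldTheory.Balaban1983to89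
open Literature.MathematicalPhysics.QuantumFieldTheory.Balaban1983to89.HiggsLattice
open Literature.MathematicalPhysics.QuantumFieldTheory.Balaban1983to89.HiggsDoubleRT
open Literature.MathematicalPhysics.QuantumFieldTheory.Balaban1983to89.B1Ineq326HiggsModel (chiW extW)
open Literature.MathematicalPhysics.QuantumFieldTheory.Balaban1983to89.B1Ineq368BoxBound
open Literature.MathematicalPhysics.QuantumFieldTheory.Balaban1983to89.B1Sect1Statements
open Literature.MathematicalPhysics.QuantumFieldTheory.Balaban1983to89.B1LowerBound114Model (Consts Inputs couplings boxConstU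
  boxConst_le_of_stop volT_nonneg)
open Literature.MathematicalPhysics.QuantumFieldTheory.Balaban1983to89.B1Eq115GeneratingFunctional (couplingsWith zRenWith_eq_partitionFn
  couplings_eq_couplingsWith)

/-! ## §1. The displayed inputs of Sects. 2–3 on one lattice, action with vacuum counterterm `E₁` -/

/-- **The displayed inputs of Sects. 2–3 on ONE lattice `P` for the action with the vacuum counterterm `E₁ P`** (constants `U` chosen
before the lattice) — field for field p14's `B1LowerBound114Model.Inputs D U P` with the single change
`h0 : S 0 = action D.C (couplingsWith D P (E₁ P))` (`S^{(0)} = S^ε`, the renormalized action (1.11) with `E = E₀ + E₁`): the number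
`K ≤` the `K` of (1.2) of renormalization steps with the stopping rule `L^Kε ≤ ε₀ < L^{K+1}ε` (p. 624); the thresholds `(ℓ_k, p_k)` of the
restrictions (3.27)–(3.28); the effective actions `S^{(k)}` with `exp(−S^{(k)}) ∈ L¹` (`k ≤ K`); the step bound `h360` of the induction
(3.26) ((3.38) with (3.51), (3.55), (3.60), pp. 618–623) at the levels `k < K`; the quadratic forms and the interaction `V^{(K),ε}` of (3.66)
with (E1) the expansion of Prop. 3.1 on the support of `χ_K` (constant `C₁`), (E2) `|V^{(K),ε}| ≤ C₂|T_ε|` (Prop. 3.2, p. 625), (E3)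
`χ_K = 1` on the small-field set of (3.67) of radius `r ≥ r₀`, `0 ≤ ½(forms) ≤ C₅|T_ε|` there, and the (3.69) conjunct
`Z_KZ_K(0)e^{−E₀} ≥ e^{−C₆|T_ε|}`. [cite: Balaban1982Higgs1, (1.10)–(1.13) pp.605–606; (3.26) p.617; (3.60) p.623; (3.66)–(3.69) pp.624–625] -/
structure InputsWith (D : ModelData) (U : Consts) (E₁ : Params → ℝ) (P : Params) where
  K : ℕ
  hKP : K ≤ P.K
  hKε : P.mesh K ≤ U.ε₀
  hstop : U.ε₀ < P.mesh (K + 1)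
  ℓ : ℕ → ℝ
  p : ℕ → ℝ
  S : (k : ℕ) → VecField P k → ScalarField P k D.N → ℝ
  h0 : S 0 = action D.C (couplingsWith D P (E₁ P))
  hS : ∀ k, k ≤ K → Integrable fun Φ : VecField P k × ScalarField P k D.N => Real.exp (-S k Φ.1 Φ.2)
  h360 : ∀ k, k < K → ∀ (B : VecField P (k + 1)) (ψ : ScalarField P (k + 1) D.N),
    chiW D.C ℓ p D.mu0sq D.msq U.a (k + 1) B ψ ≠ 0 →
      Real.exp (-S (k + 1) B ψ) * Real.exp (-(U.Cst * P.mesh k ^ U.κ₀ * P.vol 0 Finset.univ))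
        ≤ doubleRTk D.C U.a (extW D.mu0sq U.a k) (fun A φ => chiW D.C ℓ p D.mu0sq D.msq U.a k A φ * Real.exp (-S k A φ)) B ψ
  qA : VecField P K × ScalarField P K D.N → ℝ
  qφ0 : VecField P K × ScalarField P K D.N → ℝ
  V : VecField P K × ScalarField P K D.N → ℝ
  hqAm : Measurable qA
  hqφm : Measurable qφ0
  ZK : ℝ
  ZK0 : ℝ
  E₀ : ℝ
  r : ℝ
  hZK : 0 ≤ ZK
  hZK0 : 0 ≤ ZK0
  hr : U.r₀ ≤ r
  hE1 : ∀ ω : VecField P K × ScalarField P K D.N, chiW D.C ℓ p D.mu0sq D.msq U.a K ω.1 ω.2 ≠ 0 →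
    ZK * ZK0 * Real.exp (-(qA ω) / 2 - qφ0 ω / 2 + V ω - E₀ - U.C₁ * P.vol 0 Finset.univ) ≤ Real.exp (-S K ω.1 ω.2)
  hE2 : ∀ ω : VecField P K × ScalarField P K D.N, chiW D.C ℓ p D.mu0sq D.msq U.a K ω.1 ω.2 ≠ 0 →
    |V ω| ≤ U.C₂ * P.vol 0 Finset.univ
  hE3 : ∀ ω ∈ smallSet P D.N K r, chiW D.C ℓ p D.mu0sq D.msq U.a K ω.1 ω.2 = 1
  hQ : ∀ ω ∈ smallSet P D.N K r, 0 ≤ qA ω / 2 + qφ0 ω / 2 ∧ qA ω / 2 + qφ0 ω / 2 ≤ U.C₅ * P.vol 0 Finset.univ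
  h369 : Real.exp (-U.C₆ * P.vol 0 Finset.univ) ≤ ZK * ZK0 * Real.exp (-E₀)

/-- DICTIONARY: p14's v1.0 ledger IS the generic ledger at `E₁ = e1` (the v1.0 `couplings D P` is `couplingsWith D P (D.e1 P)`
definitionally — the typer's `couplings_eq_couplingsWith`). [cite: Balaban1982Higgs1, (1.10)–(1.13) pp.605–606, dictionary] -/
def Inputs.toWith {D : ModelData} {U : Consts} {P : Params} (I : Inputs D U P) : InputsWith D U D.e1 P where
  K := I.K
  hKP := I.hKP
  hKε := I.hKε
  hstop := I.hstop
  ℓ := I.ℓ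
  p := I.p
  S := I.S
  h0 := I.h0
  hS := I.hS
  h360 := I.h360
  qA := I.qA
  qφ0 := I.qφ0
  V := I.V
  hqAm := I.hqAm
  hqφm := I.hqφm
  ZK := I.ZK
  ZK0 := I.ZK0
  E₀ := I.E₀
  r := I.r
  hZK := I.hZK
  hZK0 := I.hZK0
  hr := I.hr
  hE1 := I.hE1
  hE2 := I.hE2
  hE3 := I.hE3
  hQ := I.hQ
  h369 := I.h369

/-- DICTIONARY (converse): the generic ledger at `E₁ = e1` is p14's v1.0 ledger. [cite: Balaban1982Higgs1, (1.10)–(1.13) pp.605–606, dictionary] -/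
def InputsWith.toInputs {D : ModelData} {U : Consts} {P : Params} (I : InputsWith D U D.e1 P) : Inputs D U P where
  K := I.K
  hKP := I.hKP
  hKε := I.hKε
  hstop := I.hstop
  ℓ := I.ℓ
  p := I.p
  S := I.S
  h0 := I.h0
  hS := I.hS
  h360 := I.h360
  qA := I.qA
  qφ0 := I.qφ0
  V := I.V
  hqAm := I.hqAm
  hqφm := I.hqφm
  ZK := I.ZK
  ZK0 := I.ZK0
  E₀ := I.E₀
  r := I.r
  hZK := I.hZK
  hZK0 := I.hZK0
  hr := I.hr
  hE1 := I.hE1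
  hE2 := I.hE2
  hE3 := I.hE3
  hQ := I.hQ
  h369 := I.h369

/-! ## §2. The lower bound of (1.14) for the counterterm-generic concrete family -/

/-- **Per lattice, uniform constant, arbitrary vacuum counterterm**: on an admissible lattice (`d, L, M` of the model) with *"m² > 0"* and
`L > 1`, the inputs for the action with counterterm `E₁ P` give `exp(−E₋|T_ε|) ≤ Z^ε = zRenWith P (E₁ P)` with the ε-INDEPENDENT
`E₋ = U.eMinus D` — p14's engine `B1Ineq368BoxBound.lowerBound_model` at the couplings `couplingsWith D P (E₁ P)`, then
`C₄(L^Kε, r) ≤ C₄(ε₀/L, r₀)` (`boxConst_le_of_stop`) and `|T_ε| ≥ 0`.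
[cite: Balaban1982Higgs1, Theorem (1.14) p.606; (3.68)–(3.69) p.625; p.624 (before (3.66))] -/
theorem lowerBound_latticeWith (D : ModelData) (hm : 0 < D.msq) (hL : 1 < D.L) (U : Consts) (E₁ : Params → ℝ) {P : Params}
    (hP : D.Admissible P) (I : InputsWith D U E₁ P) : Real.exp (-(U.eMinus D * volT P)) ≤ D.zRenWith P (E₁ P) := by
  obtain ⟨hd, hPL, -⟩ := hP
  have hPL' : (P.L : ℝ) = D.L := by exact_mod_cast hPL
  have hL' : 1 < (P.L : ℝ) := by
    rw [hPL']
    exact_mod_cast hL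
  have h := lowerBound_model D.C I.ℓ I.p D.mu0sq U.ha hm hL' I.hKP (couplingsWith D P (E₁ P)) I.S I.h0 I.hS U.hC U.hκ₀ I.hKε
    I.h360 I.hqAm I.hqφm I.hZK I.hZK0 (U.hr₀.trans_le I.hr) I.hE1 I.hE2 I.hE3 I.hQ I.h369
  have hbox : boxConst P D.N I.K I.r ≤ boxConstU D.d D.N (U.ε₀ / D.L) U.r₀ := by
    have hb := boxConst_le_of_stop (N := D.N) hd U.hε₀ I.hstop U.hr₀ I.hr
    rwa [hPL'] at hb
  have hE : (U.C₁ + U.C₂ + U.Cst * (U.ε₀ ^ U.κ₀ / ((P.L : ℝ) ^ U.κ₀ - 1)) + boxConst P D.N I.K I.r + U.C₅) + U.C₆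
      ≤ U.eMinus D := by
    rw [hPL']
    unfold Consts.eMinus
    linarith
  rw [zRenWith_eq_partitionFn]
  refine le_trans ?_ h
  rw [neg_mul, Real.exp_le_exp]
  exact neg_le_neg (mul_le_mul_of_nonneg_right hE (volT_nonneg P))

/-- **Theorem (1.14), lower half, FOR THE COUNTERTERM-GENERIC CONCRETE FAMILY**: if every admissible lattice carries the inputs of
Sects. 2–3 for the action with counterterm `E₁` (constants `U` chosen before the lattice), then `exp(−E₋|T_ε|) ≤ Z^ε` on the whole
family `cutoffFamilyWith E₁` with the ONE constant `E₋ = U.eMinus D` — r14's `B1LowerBound.LowerBoundWith` at r01's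
`ModelData.cutoffFamilyWith E₁`. [cite: Balaban1982Higgs1, Theorem (1.14) p.606; (3.68)–(3.69) p.625] -/
theorem lowerBoundWith_cutoffFamilyWith (D : ModelData) (hm : 0 < D.msq) (hL : 1 < D.L) (U : Consts) (E₁ : Params → ℝ)
    (h : ∀ P : Params, D.Admissible P → Nonempty (InputsWith D U E₁ P)) :
    B1LowerBound.LowerBoundWith (D.cutoffFamilyWith E₁) (U.eMinus D) := by
  intro i
  obtain ⟨I⟩ := h i.1 i.2
  exact lowerBound_latticeWith D hm hL U E₁ i.2 I

/-- *"there exist the constant E₋ independent of ε, T_ε"* with `exp(−E₋|T_ε|) ≤ Z^ε`, for the counterterm-generic family: r14's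
`B1LowerBound.LowerBoundPrinted` at `cutoffFamilyWith E₁`, from the inputs. [cite: Balaban1982Higgs1, Theorem (1.14) p.606] -/
theorem lowerBoundPrinted_cutoffFamilyWith (D : ModelData) (hm : 0 < D.msq) (hL : 1 < D.L) (U : Consts) (E₁ : Params → ℝ)
    (h : ∀ P : Params, D.Admissible P → Nonempty (InputsWith D U E₁ P)) :
    B1LowerBound.LowerBoundPrinted (D.cutoffFamilyWith E₁) :=
  ⟨U.eMinus D, lowerBoundWith_cutoffFamilyWith D hm hL U E₁ h⟩

/-- **r01's `LowerBound114With D E₁`** — the lower half of the concrete Theorem with the vacuum counterterm `E₁` (its standing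
hypothesis *"m² > 0"* feeds the restrictions) — from the inputs with constants chosen before the lattice.
[cite: Balaban1982Higgs1, Theorem (1.14) p.606; (3.68)–(3.69) p.625] -/
theorem lowerBound114With_of_inputs (D : ModelData) (hL : 1 < D.L) (U : Consts) (E₁ : Params → ℝ)
    (h : ∀ P : Params, D.Admissible P → Nonempty (InputsWith D U E₁ P)) : LowerBound114With D E₁ :=
  fun _ _ hm _ _ => lowerBoundPrinted_cutoffFamilyWith D hm hL U E₁ h

/-- DICTIONARY: unfolded (r01's `lowerBoundPrinted_cutoffFamilyWith_iff` made explicit with the constant), the conclusion reads verbatim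
as the lower bound of (1.14) on every admissible lattice: `exp(−E₋|T_ε|) ≤ Z^ε = zRenWith P (E₁ P)`, `E₋ = U.eMinus D` fixed before
`ε, T_ε`. [cite: Balaban1982Higgs1, Theorem (1.14) p.606] -/
theorem lowerBound_explicitWith (D : ModelData) (hm : 0 < D.msq) (hL : 1 < D.L) (U : Consts) (E₁ : Params → ℝ)
    (h : ∀ P : Params, D.Admissible P → Nonempty (InputsWith D U E₁ P)) :
    ∀ P : Params, D.Admissible P → Real.exp (-(U.eMinus D * volT P)) ≤ D.zRenWith P (E₁ P) :=
  fun P hP => (h P hP).elim (lowerBound_latticeWith D hm hL U E₁ hP)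

/-! ## §3. The two instances: the repaired reading `e1R` (decl of record) and the v1.0 reading `e1` -/

/-- **THE LOWER HALF OF (1.14) AT THE REPAIRED CONCRETE FAMILY — r01's decl of record `LowerBound114R D`** (`Z^ε = zRenR`, the
vacuum counterterm `E₁` of (1.13) read with one-sided `λ′`-derivatives at `0⁺`): from the displayed inputs of Sects. 2–3 for the action
with counterterm `e1R` on every admissible lattice, constants chosen before the lattice.
[cite: Balaban1982Higgs1, Theorem (1.14) p.606; (1.13) p.606; (3.68)–(3.69) p.625] -/
theorem lowerBound114R_of_inputs (D : ModelData) (hL : 1 < D.L) (U : Consts)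
    (h : ∀ P : Params, D.Admissible P → Nonempty (InputsWith D U D.e1R P)) : LowerBound114R D :=
  lowerBound114With_of_inputs D hL U D.e1R h

/-- the repaired family explicitly: `exp(−E₋|T_ε|) ≤ zRenR P` on every admissible lattice. [cite: Balaban1982Higgs1, Theorem (1.14) p.606] -/
theorem lowerBound_explicitR (D : ModelData) (hm : 0 < D.msq) (hL : 1 < D.L) (U : Consts)
    (h : ∀ P : Params, D.Admissible P → Nonempty (InputsWith D U D.e1R P)) :
    ∀ P : Params, D.Admissible P → Real.exp (-(U.eMinus D * volT P)) ≤ D.zRenR P :=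
  fun P hP => by
    rw [ModelData.zRenR_eq_zRenWith]
    exact lowerBound_explicitWith D hm hL U D.e1R h P hP

/-- CONSISTENCY: p14's v1.0 `LowerBound114 D` recovered from the generic theorem at `E₁ = e1` (`LowerBound114 D` is
`LowerBound114With D D.e1`, r01's `lowerBound114_iff_lowerBound114With`). [cite: Balaban1982Higgs1, Theorem (1.14) p.606, dictionary] -/
theorem lowerBound114_of_inputsWith (D : ModelData) (hL : 1 < D.L) (U : Consts)
    (h : ∀ P : Params, D.Admissible P → Nonempty (InputsWith D U D.e1 P)) : LowerBound114 D :=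
  (lowerBound114_iff_lowerBound114With D).2 (lowerBound114With_of_inputs D hL U D.e1 h)

/-- CONSISTENCY (converse bookkeeping): p14's hypothesis (v1.0 ledgers on every admissible lattice) yields the generic hypothesis at
`E₁ = e1`, so p14's `lowerBound114_of_inputs` factors through this file. [cite: Balaban1982Higgs1, Theorem (1.14) p.606, dictionary] -/
theorem nonempty_inputsWith_e1_of_inputs {D : ModelData} {U : Consts}
    (h : ∀ P : Params, D.Admissible P → Nonempty (Inputs D U P)) :
    ∀ P : Params, D.Admissible P → Nonempty (InputsWith D U D.e1 P) :=
  fun P hP => (h P hP).map Inputs.toWith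

/-- p14's `lowerBound114_of_inputs`, re-derived through the generic ledger (same statement; a check that nothing was lost).
[cite: Balaban1982Higgs1, Theorem (1.14) p.606, dictionary] -/
theorem lowerBound114_of_inputs' (D : ModelData) (hL : 1 < D.L) (U : Consts)
    (h : ∀ P : Params, D.Admissible P → Nonempty (Inputs D U P)) : LowerBound114 D :=
  lowerBound114_of_inputsWith D hL U (nonempty_inputsWith_e1_of_inputs h)

end Literature.MathematicalPhysics.QuantumFieldTheory.Balaban1983to89.B1LowerBound114ModelWith
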